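/-
Copyright (c) 2026. All rights reserved.
Released under Apache 2.0 license as described in the file LICENSE.
-/
import Literature.NumberTheory.ComplexMultiplication.DegenerateCMTypesElementaryAbelianOrderSixteen
import Literature.NumberTheory.ComplexMultiplication.DegenerateCMTypesAbelianStabilizerCharacters
import Literature.NumberTheory.ComplexMultiplication.DegenerateCMTypesElementaryAbelianTitsworth
import Literature.NumberTheory.ComplexMultiplication.DegenerateCMTypesElementaryAbelianWeightTwo
import HarnessLib

/-!
# CM types on elementary abelian `2`-groups of every order: the stabiliser bounds the rank, and rank `5` forces a
# stabiliser of order `≥ |G|/8`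

SETTING.  `G` a finite commutative group of exponent `2` (the Galois group of a multiquadratic CM field), `ρ ∈ G`
(complex conjugation), `T ⊆ G` a CM type (`T ⊔ ρT = G`), `rank(T) = 1 + #{χ odd : Ŝ(χ) ≠ 0}` its Kubota rank
(T. Kubota [Kubota1965] §4 Lemma 2; tree `IsCMTypeWith.typeRank_eq_one_add_ncard_oddCharacters`), and
`Stab(T) = {g : Tg = T}` its stabiliser — the joint kernel of the surviving odd characters (tree
`AbelianStabilizer.forall_mul_mem_iff_iff_forall_survivor`).  Two order-free consequences:

> **Theorem** (`typeRank_le_of_forall_mul_mem_iff`).  If some `g ≠ 1` stabilises `T` then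
> `rank(T) ≤ |G|/4 + 1`: the survivors lie in `{χ odd : χ(g) = 1}`, a set of `|G|/4` characters.
> **Theorem** (`card_le_eight_mul_card_filter_forall_mul_mem_iff_of_typeRank_eq_five`).  If `rank(T) = 5` then
> `|G| ≤ 8·|Stab(T)|`: the four survivors are `χ₁, χ₂, χ₃, χ₁χ₂χ₃` (Titsworth's relation, tree
> `exists_survivor_of_ne`), so `Stab(T) ⊇ ker χ₁ ∩ ker χ₂ ∩ ker χ₃`, and three independent characters cut `G` into
> eight equal parts (`eight_mul_card_filter_eq_one_eq`).  Hence a rank-`5` type on a group of order `≥ 16` is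
> stabilised by some `g ≠ 1` (`exists_ne_one_forall_mul_mem_iff_of_typeRank_eq_five_of_le`), and on a group of order
> `> 16` by two distinct non-trivial elements (`exists_two_forall_mul_mem_iff_of_typeRank_eq_five`).

On the field side (multiquadratic CM fields `K` of every degree; sequel in `Pohlmann1968/`): a type induced from a
subfield of index `2` has rank `≤ [K:ℚ]/4 + 1`, and a rank-`5` type is induced from an OCTIC subfield, from a
nondegenerate type — so the Hodge conjecture holds for all powers of its abelian varieties (Pohlmann–Hazama).

* §1 `card_survivors_le_of_forall_mul_mem_iff`, **`typeRank_le_of_forall_mul_mem_iff`**.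
* §2 `eight_mul_card_filter_eq_one_eq`, `exists_survivors_eq_of_typeRank_eq_five`,
  **`card_le_eight_mul_card_filter_forall_mul_mem_iff_of_typeRank_eq_five`**,
  `exists_ne_one_forall_mul_mem_iff_of_typeRank_eq_five_of_le`, `exists_two_forall_mul_mem_iff_of_typeRank_eq_five`,
  `typeRank_ne_five_of_forall`.

HONEST SCOPE.  Elementary character-sum arguments; the sources print Kubota's formula and (for Boolean functions)
Titsworth's relation, the regrouping is the file's.  THEOREMS ONLY: no definition, no named fact, no instance, no
`sorry`.

## References

* [Kubota1965] T. Kubota, *On the field extension by complex multiplication*, Trans. AMS 118 (1965), §2, §4 Lemma 2.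
* [Dodson1984] B. Dodson, *The structure of Galois groups of CM-fields*, Trans. AMS 283 (1984), §3.1.1 Theorem.
* [Carlet2020] C. Carlet, *Boolean Functions for Cryptography and Coding Theory*, CUP, §2.3 (2.51).
* [Gordon1999HodgeAVSurvey] B. B. Gordon, *A survey of the Hodge conjecture for abelian varieties*, Prop. 9.4.1.

## Provenance

Lane `lit-hodgefound` (Track 2, Layer A3), seat `lit-hodgefound-p10` generation 38, row g38-#7a; neighbours cited by
name, nothing restated: `DegenerateCMTypesAbelianStabilizerCharacters` (`AbelianStabilizer.forall_mul_mem_iff_of_forall_survivor`,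
`survivor_apply_eq_one_of_forall_mul_mem_iff`), `DegenerateCMTypesElementaryAbelianWeightTwo`
(`four_mul_card_odd_filter_eq`), `DegenerateCMTypesElementaryAbelianTitsworth` (`exists_survivor_of_ne`,
`add_self_eq_zero_char`), `DegenerateCMTypesElementaryAbelianOrderSixteen` (`card_survivors_eq_four_of_typeRank_eq_five`),
`CMTypeRankCharacters` (`IsCMTypeWith.typeRank_eq_one_add_ncard_oddCharacters`), `CMTypeElementaryTwoGroupOddWeights`
(`sum_character_eq_zero_of_ne_zero`, `character_apply_eq_one_or_of_mul_self`).
-/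

open scoped BigOperators Classical

namespace Literature.NumberTheory.ComplexMultiplication

namespace CyclicCMType

namespace ExponentTwo

variable {G : Type*} [CommGroup G] [Fintype G] [DecidableEq G] {ρ : G} {T : Finset G}

/-! ## §0 Helpers -/

section Helpers

omit [Fintype G] [DecidableEq G] in
/-- `g·g = 1` in exponent `2`. [folklore] -/
private theorem mul_self_eq_one_sr (hexp : ∀ g : G, g ^ 2 = 1) (g : G) : g * g = 1 := by
  rw [← pow_two]; exact hexp g

omit [Fintype G] [DecidableEq G] in
/-- Characters of a group of exponent `2` are `±1`-valued. [cite: Kubota1965, §4 Lemma 2 (proof)] -/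
private theorem char_eq_one_or_sr (hexp : ∀ g : G, g ^ 2 = 1) (χ : AddChar (Additive G) ℂ) (g : G) :
    χ (Additive.ofMul g) = 1 ∨ χ (Additive.ofMul g) = -1 :=
  character_apply_eq_one_or_of_mul_self χ (mul_self_eq_one_sr hexp g)

omit [Fintype G] [DecidableEq G] in
/-- `χ(gh) = χ(g)χ(h)`. [folklore] -/
private theorem char_mul_sr (χ : AddChar (Additive G) ℂ) (g h : G) :
    χ (Additive.ofMul (g * h)) = χ (Additive.ofMul g) * χ (Additive.ofMul h) := by
  rw [ofMul_mul, AddChar.map_add_eq_mul]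

omit [Fintype G] [DecidableEq G] in
/-- `ρ² = 1`. [folklore] -/
private theorem rho_mul_rho_sr (h : IsCMTypeWith ρ (T : Set G)) : ρ * ρ = 1 := by
  have := h.invol (1 : G)
  simpa [smul_eq_mul] using this

omit [Fintype G] [DecidableEq G] in
/-- `ρ ≠ 1`. [folklore] -/
private theorem rho_ne_one_sr (h : IsCMTypeWith ρ (T : Set G)) : ρ ≠ 1 := by
  intro hρ
  have := h.rho_smul_ne (1 : G)
  rw [hρ, smul_eq_mul, one_mul] at this
  exact this rfl

omit [Fintype G] [DecidableEq G] in
/-- `ρx ∈ T ⟺ x ∉ T`. [folklore] -/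
private theorem rho_mul_mem_iff_sr (h : IsCMTypeWith ρ (T : Set G)) (x : G) : ρ * x ∈ T ↔ x ∉ T := by
  have := h.rho_smul_mem_iff x
  simpa only [smul_eq_mul, Finset.mem_coe] using this

/-- `|G| = 2|T|`. [folklore] -/
private theorem two_mul_card_sr (h : IsCMTypeWith ρ (T : Set G)) : 2 * T.card = Fintype.card G := by
  have hinj : Function.Injective fun s : G => ρ * s := fun a b hab => mul_left_cancel hab
  have hc : Tᶜ = T.image fun s => ρ * s := by
    ext x
    rw [Finset.mem_compl, Finset.mem_image]
    constructor
    · intro hx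
      refine ⟨ρ * x, (rho_mul_mem_iff_sr h x).2 hx, ?_⟩
      rw [← mul_assoc, rho_mul_rho_sr h, one_mul]
    · rintro ⟨s, hs, rfl⟩
      exact fun hx => ((rho_mul_mem_iff_sr h s).1 hx) hs
  have h1 : Tᶜ.card = T.card := by rw [hc, Finset.card_image_of_injective _ hinj]
  have h2 := Finset.card_add_card_compl T
  omega

omit [DecidableEq G] in
/-- The set of surviving odd characters as a finset. [cite: Kubota1965, §4 Lemma 2] -/
private theorem ncard_survivors_eq_sr (T : Finset G) (ρ : G) :
    {χ : AddChar (Additive G) ℂ | χ (Additive.ofMul ρ) = -1 ∧ ∑ s ∈ T, χ (Additive.ofMul s) ≠ 0}.ncard =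
      ((Finset.univ.filter fun χ : AddChar (Additive G) ℂ => χ (Additive.ofMul ρ) = -1).filter
        fun χ => ∑ s ∈ T, χ (Additive.ofMul s) ≠ 0).card := by
  rw [← Set.ncard_coe_finset]
  congr 1
  ext χ
  simp only [Set.mem_setOf_eq, Finset.coe_filter, Finset.mem_filter, Finset.mem_univ, true_and]

/-- Kubota's count with the survivors as a finset: `rank = 1 + #surv`. [cite: Kubota1965, §4 Lemma 2] -/
private theorem typeRank_eq_one_add_card_sr (h : IsCMTypeWith ρ (T : Set G)) :
    typeRank G (T : Set G) = 1 + ((Finset.univ.filter fun χ : AddChar (Additive G) ℂ =>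
      χ (Additive.ofMul ρ) = -1).filter fun χ => ∑ s ∈ T, χ (Additive.ofMul s) ≠ 0).card := by
  rw [h.typeRank_eq_one_add_ncard_oddCharacters, ncard_survivors_eq_sr]

end Helpers

/-! ## §1 A non-trivial stabiliser halves the possible survivors -/

section StabilizerBound

/-- **The survivors of a type stabilised by `g ≠ 1` lie in `{χ odd : χ(g) = 1}`**, a set of `|G|/4` characters:
`4·#surv ≤ |G|`. [cite: Kubota1965, §4 Lemma 2] [cite: Dodson1984, §3.1.1 Theorem] -/
theorem card_survivors_le_of_forall_mul_mem_iff (hexp : ∀ g : G, g ^ 2 = 1) (h : IsCMTypeWith ρ (T : Set G))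
    {g : G} (hg1 : g ≠ 1) (hg : ∀ t : G, t * g ∈ T ↔ t ∈ T) :
    4 * ((Finset.univ.filter fun χ : AddChar (Additive G) ℂ => χ (Additive.ofMul ρ) = -1).filter
      fun χ => ∑ s ∈ T, χ (Additive.ofMul s) ≠ 0).card ≤ Fintype.card G := by
  have hgρ : g ≠ ρ := by
    intro hgρ
    obtain ⟨t, ht⟩ : T.Nonempty := by
      rw [← Finset.card_pos]; have := two_mul_card_sr h; have : 0 < Fintype.card G := Fintype.card_pos; omega
    have h1 := (hg t).2 ht
    rw [hgρ, mul_comm, rho_mul_mem_iff_sr h t] at h1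
    exact h1 ht
  have hsub : ((Finset.univ.filter fun χ : AddChar (Additive G) ℂ => χ (Additive.ofMul ρ) = -1).filter
      fun χ => ∑ s ∈ T, χ (Additive.ofMul s) ≠ 0) ⊆
      ((Finset.univ.filter fun χ : AddChar (Additive G) ℂ => χ (Additive.ofMul ρ) = -1).filter
      fun χ => χ (Additive.ofMul g) = 1) := by
    intro χ hχ
    rw [Finset.mem_filter] at hχ ⊢
    exact ⟨hχ.1, AbelianStabilizer.survivor_apply_eq_one_of_forall_mul_mem_iff hg (Finset.mem_filter.1 hχ.1).2 hχ.2⟩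
  have hW := four_mul_card_odd_filter_eq hexp (rho_ne_one_sr h) hg1 hgρ
  have := Finset.card_le_card hsub
  omega

/-- **AN IMPRIMITIVE TYPE ON A GROUP OF EXPONENT `2` HAS RANK AT MOST `|G|/4 + 1`**: if some `g ≠ 1` stabilises
`T` then `rank(T) ≤ |G|/4 + 1` (on the field side: a type induced from a subfield of index `2` has rank at most
`[K:ℚ]/4 + 1`). [cite: Kubota1965, §2 and §4 Lemma 2] -/
theorem typeRank_le_of_forall_mul_mem_iff (hexp : ∀ g : G, g ^ 2 = 1) (h : IsCMTypeWith ρ (T : Set G))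
    {g : G} (hg1 : g ≠ 1) (hg : ∀ t : G, t * g ∈ T ↔ t ∈ T) :
    typeRank G (T : Set G) ≤ Fintype.card G / 4 + 1 := by
  have h1 := card_survivors_le_of_forall_mul_mem_iff hexp h hg1 hg
  have h2 := typeRank_eq_one_add_card_sr h
  omega

end StabilizerBound

/-! ## §2 Rank `5`: the stabiliser has order at least `|G|/8` -/

section RankFive

omit [DecidableEq G] in
/-- **Three independent characters cut `G` into eight equal parts**: `8·#{g : χ₁(g) = χ₂(g) = χ₃(g) = 1} = |G|`
for non-trivial characters `χ₁, χ₂, χ₃` of a group of exponent `2` all of whose products are non-trivial (expand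
`Σ_g (1 + χ₁(g))(1 + χ₂(g))(1 + χ₃(g))`: every proper product sums to `0`). [cite: Kubota1965, §4 Lemma 2 (proof)] -/
theorem eight_mul_card_filter_eq_one_eq (hexp : ∀ g : G, g ^ 2 = 1) {χ₁ χ₂ χ₃ : AddChar (Additive G) ℂ}
    (h1 : χ₁ ≠ 0) (h2 : χ₂ ≠ 0) (h3 : χ₃ ≠ 0) (h12 : χ₁ + χ₂ ≠ 0) (h13 : χ₁ + χ₃ ≠ 0) (h23 : χ₂ + χ₃ ≠ 0)
    (h123 : χ₁ + χ₂ + χ₃ ≠ 0) :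
    8 * (Finset.univ.filter fun g : G => χ₁ (Additive.ofMul g) = 1 ∧ χ₂ (Additive.ofMul g) = 1 ∧
      χ₃ (Additive.ofMul g) = 1).card = Fintype.card G := by
  have hkey : ∀ g : G, (1 + χ₁ (Additive.ofMul g)) * (1 + χ₂ (Additive.ofMul g)) * (1 + χ₃ (Additive.ofMul g)) =
      if χ₁ (Additive.ofMul g) = 1 ∧ χ₂ (Additive.ofMul g) = 1 ∧ χ₃ (Additive.ofMul g) = 1 then (8 : ℂ) else 0 := by
    intro g
    rcases char_eq_one_or_sr hexp χ₁ g with e1 | e1 <;> rcases char_eq_one_or_sr hexp χ₂ g with e2 | e2 <;>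
      rcases char_eq_one_or_sr hexp χ₃ g with e3 | e3 <;> simp only [e1, e2, e3] <;> norm_num
  have hsum : ∑ g : G, (1 + χ₁ (Additive.ofMul g)) * (1 + χ₂ (Additive.ofMul g)) * (1 + χ₃ (Additive.ofMul g)) =
      8 * ((Finset.univ.filter fun g : G => χ₁ (Additive.ofMul g) = 1 ∧ χ₂ (Additive.ofMul g) = 1 ∧
        χ₃ (Additive.ofMul g) = 1).card : ℂ) := by
    rw [Finset.sum_congr rfl fun g _ => hkey g, ← Finset.sum_filter, Finset.sum_const, nsmul_eq_mul, mul_comm]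
  have hexpand : ∀ g : G,
      (1 + χ₁ (Additive.ofMul g)) * (1 + χ₂ (Additive.ofMul g)) * (1 + χ₃ (Additive.ofMul g)) =
      1 + χ₁ (Additive.ofMul g) + χ₂ (Additive.ofMul g) + χ₃ (Additive.ofMul g) + (χ₁ + χ₂) (Additive.ofMul g) +
        (χ₁ + χ₃) (Additive.ofMul g) + (χ₂ + χ₃) (Additive.ofMul g) + (χ₁ + χ₂ + χ₃) (Additive.ofMul g) := by
    intro g
    simp only [AddChar.add_apply]
    ring
  rw [Finset.sum_congr rfl fun g _ => hexpand g] at hsum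
  simp only [Finset.sum_add_distrib, sum_character_eq_zero_of_ne_zero h1, sum_character_eq_zero_of_ne_zero h2,
    sum_character_eq_zero_of_ne_zero h3, sum_character_eq_zero_of_ne_zero h12, sum_character_eq_zero_of_ne_zero h13,
    sum_character_eq_zero_of_ne_zero h23, sum_character_eq_zero_of_ne_zero h123, add_zero, Finset.sum_const,
    Finset.card_univ, nsmul_eq_mul, mul_one] at hsum
  exact_mod_cast hsum.symm

/-- **The four survivors of a rank-`5` type are `χ₁, χ₂, χ₃, χ₁χ₂χ₃`** for three distinct odd characters (every
order): two survivors `χ₁ ≠ χ₂` force, by Titsworth's relation for `ψ = χ₁χ₂` (tree `exists_survivor_of_ne`), a third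
survivor `χ₃` with `χ₃χ₁χ₂` surviving too, and `1 + 4 = rank` leaves no room for more.
[cite: Carlet2020, §2.3 (2.51) (p. 61)] [cite: Kubota1965, §4 Lemma 2] -/
theorem exists_survivors_eq_of_typeRank_eq_five (hexp : ∀ g : G, g ^ 2 = 1) (h : IsCMTypeWith ρ (T : Set G))
    (hr : typeRank G (T : Set G) = 5) :
    ∃ χ₁ χ₂ χ₃ : AddChar (Additive G) ℂ, χ₁ (Additive.ofMul ρ) = -1 ∧ χ₂ (Additive.ofMul ρ) = -1 ∧
      χ₃ (Additive.ofMul ρ) = -1 ∧ χ₁ ≠ χ₂ ∧ χ₁ ≠ χ₃ ∧ χ₂ ≠ χ₃ ∧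
      ((Finset.univ.filter fun χ : AddChar (Additive G) ℂ => χ (Additive.ofMul ρ) = -1).filter
        fun χ => ∑ s ∈ T, χ (Additive.ofMul s) ≠ 0) = {χ₁, χ₂, χ₃, χ₃ + (χ₁ + χ₂)} := by
  set surv := (Finset.univ.filter fun χ : AddChar (Additive G) ℂ => χ (Additive.ofMul ρ) = -1).filter
      fun χ => ∑ s ∈ T, χ (Additive.ofMul s) ≠ 0 with hsurv
  have h4 : surv.card = 4 := card_survivors_eq_four_of_typeRank_eq_five h hr
  have hmem : ∀ χ : AddChar (Additive G) ℂ, χ ∈ surv ↔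
      χ (Additive.ofMul ρ) = -1 ∧ ∑ s ∈ T, χ (Additive.ofMul s) ≠ 0 := fun χ => by
    rw [hsurv, Finset.mem_filter, Finset.mem_filter]
    exact ⟨fun hh => ⟨hh.1.2, hh.2⟩, fun hh => ⟨⟨Finset.mem_univ _, hh.1⟩, hh.2⟩⟩
  obtain ⟨χ₁, hχ₁s, χ₂, hχ₂s, hne⟩ := Finset.one_lt_card.1 (by rw [h4]; norm_num)
  obtain ⟨hχ₁, hS₁⟩ := (hmem χ₁).1 hχ₁s
  obtain ⟨hχ₂, hS₂⟩ := (hmem χ₂).1 hχ₂s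
  obtain ⟨χ₃, hχ₃, h31, h32, hS₃, hS₄⟩ := exists_survivor_of_ne hexp h hχ₁ hχ₂ hne hS₁ hS₂
  set χ₄ := χ₃ + (χ₁ + χ₂) with hχ₄
  have hχ₄ρ : χ₄ (Additive.ofMul ρ) = -1 := by
    rw [hχ₄, AddChar.add_apply, AddChar.add_apply, hχ₁, hχ₂, hχ₃]; norm_num
  have hχ₃s : χ₃ ∈ surv := (hmem χ₃).2 ⟨hχ₃, hS₃⟩
  have hχ₄s : χ₄ ∈ surv := (hmem χ₄).2 ⟨hχ₄ρ, hS₄⟩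
  have h11 := add_self_eq_zero_char hexp χ₁
  have h22 := add_self_eq_zero_char hexp χ₂
  have h43 : χ₄ ≠ χ₃ := by
    intro h0
    apply hne
    have : χ₃ + (χ₁ + χ₂) = χ₃ + 0 := by rw [← hχ₄, h0, add_zero]
    have h12 : χ₁ + χ₂ = 0 := add_left_cancel this
    have : χ₁ + χ₂ = χ₂ + χ₂ := by rw [h12, h22]
    exact add_right_cancel this
  have h41 : χ₄ ≠ χ₁ := by
    intro h0
    apply h32
    have h' : χ₃ + χ₂ + χ₁ = 0 + χ₁ := by
      rw [zero_add, add_assoc, add_comm χ₂ χ₁, ← hχ₄]; exact h0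
    have h32' : χ₃ + χ₂ = 0 := add_right_cancel h'
    have : χ₃ + χ₂ = χ₂ + χ₂ := by rw [h32', h22]
    exact add_right_cancel this
  have h42 : χ₄ ≠ χ₂ := by
    intro h0
    apply h31
    have h' : χ₃ + χ₁ + χ₂ = 0 + χ₂ := by
      rw [zero_add, add_assoc, ← hχ₄]; exact h0
    have h31' : χ₃ + χ₁ = 0 := add_right_cancel h'
    have : χ₃ + χ₁ = χ₁ + χ₁ := by rw [h31', h11]
    exact add_right_cancel this
  have hfour : ({χ₁, χ₂, χ₃, χ₄} : Finset (AddChar (Additive G) ℂ)) = surv := by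
    refine Finset.eq_of_subset_of_card_le (fun χ hχ => ?_) ?_
    · simp only [Finset.mem_insert, Finset.mem_singleton] at hχ
      rcases hχ with h0 | h0 | h0 | h0 <;> rw [h0]
      exacts [hχ₁s, hχ₂s, hχ₃s, hχ₄s]
    · rw [h4, Finset.card_insert_of_notMem, Finset.card_insert_of_notMem, Finset.card_insert_of_notMem,
        Finset.card_singleton]
      · rw [Finset.mem_singleton]; exact h43.symm
      · simp only [Finset.mem_insert, Finset.mem_singleton, not_or]; exact ⟨h32.symm, h42.symm⟩
      · simp only [Finset.mem_insert, Finset.mem_singleton, not_or]; exact ⟨hne, h31.symm, h41.symm⟩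
  exact ⟨χ₁, χ₂, χ₃, hχ₁, hχ₂, hχ₃, hne, h31.symm, h32.symm, hfour.symm⟩

/-- **RANK `5` ⟹ `|G| ≤ 8·|Stab(T)|`, ON A GROUP OF EXPONENT `2` OF EVERY ORDER**: the stabiliser — the joint
kernel of the survivors `χ₁, χ₂, χ₃, χ₁χ₂χ₃` (tree `AbelianStabilizer.forall_mul_mem_iff_of_forall_survivor`) —
contains `ker χ₁ ∩ ker χ₂ ∩ ker χ₃`, of order `|G|/8`.  On the field side: a rank-`5` type of a multiquadratic CM
field is induced from a subfield of degree `≤ 8`. [cite: Kubota1965, §2 and §4 Lemma 2] [cite: Carlet2020, §2.3 (2.51) (p. 61)] -/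
theorem card_le_eight_mul_card_filter_forall_mul_mem_iff_of_typeRank_eq_five (hexp : ∀ g : G, g ^ 2 = 1)
    (h : IsCMTypeWith ρ (T : Set G)) (hr : typeRank G (T : Set G) = 5) :
    Fintype.card G ≤ 8 * (Finset.univ.filter fun g : G => ∀ t : G, t * g ∈ T ↔ t ∈ T).card := by
  obtain ⟨χ₁, χ₂, χ₃, hχ₁, hχ₂, hχ₃, h12, h13, h23, hsurv⟩ := exists_survivors_eq_of_typeRank_eq_five hexp h hr
  -- the joint kernel of `χ₁, χ₂, χ₃` stabilises
  have hK : (Finset.univ.filter fun g : G => χ₁ (Additive.ofMul g) = 1 ∧ χ₂ (Additive.ofMul g) = 1 ∧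
      χ₃ (Additive.ofMul g) = 1) ⊆ Finset.univ.filter fun g : G => ∀ t : G, t * g ∈ T ↔ t ∈ T := by
    intro g hg
    simp only [Finset.mem_filter, Finset.mem_univ, true_and] at hg ⊢
    refine AbelianStabilizer.forall_mul_mem_iff_of_forall_survivor h fun χ hχ hS => ?_
    have hχs : χ ∈ ((Finset.univ.filter fun χ : AddChar (Additive G) ℂ => χ (Additive.ofMul ρ) = -1).filter
        fun χ => ∑ s ∈ T, χ (Additive.ofMul s) ≠ 0) := by
      simp only [Finset.mem_filter, Finset.mem_univ, true_and]
      exact ⟨hχ, hS⟩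
    rw [hsurv] at hχs
    simp only [Finset.mem_insert, Finset.mem_singleton] at hχs
    rcases hχs with h0 | h0 | h0 | h0 <;> rw [h0]
    · exact hg.1
    · exact hg.2.1
    · exact hg.2.2
    · rw [AddChar.add_apply, AddChar.add_apply, hg.1, hg.2.1, hg.2.2]; norm_num
  -- the characters `χ₁, χ₂, χ₃` are independent
  have hne0 : ∀ {χ : AddChar (Additive G) ℂ}, χ (Additive.ofMul ρ) = -1 → χ ≠ 0 := by
    intro χ hχ h0
    rw [h0, AddChar.zero_apply] at hχ
    norm_num at hχ
  have hsum0 : ∀ {χ ψ : AddChar (Additive G) ℂ}, χ ≠ ψ → ψ + ψ = 0 → χ + ψ ≠ 0 := by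
    intro χ ψ hχψ hψψ h0
    apply hχψ
    calc χ = χ + (ψ + ψ) := by rw [hψψ, add_zero]
      _ = χ + ψ + ψ := by rw [add_assoc]
      _ = ψ := by rw [h0, zero_add]
  have h123 : χ₁ + χ₂ + χ₃ ≠ 0 := by
    intro h0
    have hv : (χ₁ + χ₂ + χ₃) (Additive.ofMul ρ) = -1 := by
      rw [AddChar.add_apply, AddChar.add_apply, hχ₁, hχ₂, hχ₃]; norm_num
    rw [h0, AddChar.zero_apply] at hv
    norm_num at hv
  have h22 := add_self_eq_zero_char hexp χ₂
  have h33 := add_self_eq_zero_char hexp χ₃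
  have h8 := eight_mul_card_filter_eq_one_eq hexp (hne0 hχ₁) (hne0 hχ₂) (hne0 hχ₃) (hsum0 h12 h22)
    (hsum0 h13 h33) (hsum0 h23 h33) h123
  have hle := Finset.card_le_card hK
  omega

/-- **RANK `5` ON A GROUP OF ORDER `≥ 16` ⟹ A NON-TRIVIAL STABILISER** (`|Stab(T)| ≥ 2`); on the field side the
type is imprimitive. [cite: Kubota1965, §2 and §4 Lemma 2] -/
theorem exists_ne_one_forall_mul_mem_iff_of_typeRank_eq_five_of_le (hexp : ∀ g : G, g ^ 2 = 1)
    (h : IsCMTypeWith ρ (T : Set G)) (h16 : 16 ≤ Fintype.card G) (hr : typeRank G (T : Set G) = 5) :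
    ∃ g : G, g ≠ 1 ∧ ∀ t : G, t * g ∈ T ↔ t ∈ T := by
  have hcard : 1 < (Finset.univ.filter fun g : G => ∀ t : G, t * g ∈ T ↔ t ∈ T).card := by
    have := card_le_eight_mul_card_filter_forall_mul_mem_iff_of_typeRank_eq_five hexp h hr
    omega
  obtain ⟨a, ha, b, hb, hab⟩ := Finset.one_lt_card.1 hcard
  simp only [Finset.mem_filter, Finset.mem_univ, true_and] at ha hb
  by_cases ha1 : a = 1
  · exact ⟨b, fun hb1 => hab (ha1.trans hb1.symm), hb⟩
  · exact ⟨a, ha1, ha⟩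

/-- **RANK `5` ON A GROUP OF ORDER `> 16` ⟹ TWO DISTINCT NON-TRIVIAL STABILISING ELEMENTS** (`|Stab(T)| ≥ 3`); on
the field side the type is induced from a subfield of index `≥ 4`. [cite: Kubota1965, §2 and §4 Lemma 2] -/
theorem exists_two_forall_mul_mem_iff_of_typeRank_eq_five (hexp : ∀ g : G, g ^ 2 = 1)
    (h : IsCMTypeWith ρ (T : Set G)) (h16 : 16 < Fintype.card G) (hr : typeRank G (T : Set G) = 5) :
    ∃ g₁ g₂ : G, g₁ ≠ 1 ∧ g₂ ≠ 1 ∧ g₁ ≠ g₂ ∧ (∀ t : G, t * g₁ ∈ T ↔ t ∈ T) ∧ (∀ t : G, t * g₂ ∈ T ↔ t ∈ T) := by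
  have hcard : 2 < (Finset.univ.filter fun g : G => ∀ t : G, t * g ∈ T ↔ t ∈ T).card := by
    have := card_le_eight_mul_card_filter_forall_mul_mem_iff_of_typeRank_eq_five hexp h hr
    omega
  obtain ⟨a, ha, b, hb, c, hc, hab, hac, hbc⟩ := Finset.two_lt_card.1 hcard
  simp only [Finset.mem_filter, Finset.mem_univ, true_and] at ha hb hc
  by_cases ha1 : a = 1
  · exact ⟨b, c, fun hb1 => hab (ha1.trans hb1.symm), fun hc1 => hac (ha1.trans hc1.symm), hbc, hb, hc⟩
  · by_cases hb1 : b = 1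
    · exact ⟨a, c, ha1, fun hc1 => hbc (hb1.trans hc1.symm), hac, ha, hc⟩
    · exact ⟨a, b, ha1, hb1, hab, ha, hb⟩

/-- **A type with TRIVIAL stabiliser on a group of order `≥ 16` does not have rank `5`** (on the field side: no
primitive type of a multiquadratic CM field of degree `≥ 16` has rank `5`). [cite: Kubota1965, §2 and §4 Lemma 2] -/
theorem typeRank_ne_five_of_forall (hexp : ∀ g : G, g ^ 2 = 1) (h : IsCMTypeWith ρ (T : Set G))
    (h16 : 16 ≤ Fintype.card G) (hprim : ∀ g : G, g ≠ 1 → ∃ t : G, ¬ (t * g ∈ T ↔ t ∈ T)) :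
    typeRank G (T : Set G) ≠ 5 := by
  intro hr
  obtain ⟨g, hg1, hg⟩ := exists_ne_one_forall_mul_mem_iff_of_typeRank_eq_five_of_le hexp h h16 hr
  obtain ⟨t, ht⟩ := hprim g hg1
  exact ht (hg t)

end RankFive

end ExponentTwo

end CyclicCMType

end Literature.NumberTheory.ComplexMultiplication
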